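import Literature.NumberTheory.Weil1964.ArchWeilDatum
import Literature.Analysis.SegalBargmann.SchwartzCompactWeilRep
import HarnessLib

/-!
# The constructed compact Weil representation IS an archimedean Weil datum (junction `SchwartzCompactWeilRep` × `ArchWeilDatum`)

Topic `Analysis/SegalBargmann`; namespace `Literature.Analysis.SegalBargmann`.  The hypothesis structure
`Literature.NumberTheory.Weil1964.IsArchWeilDatum ι𝕎 ω` ((w1) Schwartz continuity, (w2) Heisenberg covariance over
`ι𝕎 : G_∞ →* Sp(ℝ^σ × ℝ^σ)`, (w2′) unitary lifts) is the form in which the pub-hodgecm theta lane consumes an archimedean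
Weil representation.  For a COMPACT group mapped into `U(σ) ⊂ Sp` by `ι : H →* U(σ)` (`realifySp σ ∘ ι`) the
representation `compactWeilRep ι χ` CONSTRUCTED in `SchwartzCompactWeilRep` satisfies it, for every continuous unitary
character `χ`:

* `isArchWeilDatum_compactWeilRep : IsArchWeilDatum ((realifySp σ).comp ι) (compactWeilRep ι χ)`;
* `isArchWeilDatum_dualPairWeilRep`: the compact dual pair `(U(P)×U(Q))×(U(R)×U(S))` through `dualPairι`;
* conversely `IsArchWeilDatum.exists_eq_compactWeilRep` / `.exists_torus_weights`: an ABSTRACT datum restricted along a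
  compact `κ : K →* G_∞` with `ι𝕎 ∘ κ = realifySp ∘ ι_K` IS `compactWeilRep ι_K χ` on all of `𝓢` for one continuous
  unitary character `χ` of `K` — so its torus weights / Gaussian eigenvalue are the closed formulas.

So the datum is NON-VACUOUS at every place where both members of the dual pair are compact, with an explicit witness
whose torus weights and vacuum character are the closed formulas of `SchwartzCompactWeilRep`.  Kernel only.

## References

* [Folland1989] G. B. Folland, *Harmonic Analysis in Phase Space*, Princeton UP (1989), §4.2 (4.23), Prop. (4.39).
  [cite: Folland1989, Prop (4.39)]

## Provenance

LEAN-IN-TREE rule (2026-08-18), pub-hodgecm model-construction sub-cell, seat mc-binder-2 gen 2 ("γ3-compact").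
-/

set_option autoImplicit false

noncomputable section

open MeasureTheory Complex SchwartzMap
open scoped InnerProductSpace ComplexConjugate Real

namespace Literature.Analysis.SegalBargmann

open Literature.NumberTheory.Weil1964 Literature.RepresentationTheory.HeisenbergGroup

variable {σ : Type*} [Fintype σ] [DecidableEq σ]
variable {H : Type*} [Group H] [TopologicalSpace H]

/-- **The constructed compact Weil representation is an archimedean Weil datum** over `realifySp σ ∘ ι`:
(w1) = `continuous_compactWeilRep_apply`, (w2) = `isRhoCovariantS_compactWeilRep` read through `coe_realifySp`,
(w2′) = `liftsTo_compactWeilRep`. [cite: Folland1989, Prop (4.39)] -/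
theorem isArchWeilDatum_compactWeilRep (ι : H →* Matrix.unitaryGroup σ ℂ) (χ : H →* Circle) (hι : Continuous ι)
    (hχ : Continuous χ) : IsArchWeilDatum ((realifySp σ).comp ι) (compactWeilRep ι χ) where
  continuous_apply f := continuous_compactWeilRep_apply hι hχ f
  covariant := fun h p q f => by
    simpa only [MonoidHom.coe_comp, Function.comp_apply, coe_realifySp] using
      isRhoCovariantS_compactWeilRep ι χ h p q f
  exists_lift g := ⟨compactWeilLift ι χ g, liftsTo_compactWeilRep ι χ g⟩

/-- **Conversely, an ABSTRACT archimedean Weil datum restricted to a compact subgroup IS a `compactWeilRep`.**  Along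
`κ : K →* G_∞` (continuous) acting on phase space through unitary matrices `ι𝕎 (κ k) = realifySp (ι_K k)` there is a
continuous unitary character `χ` of `K` with `ω (κ k) = compactWeilRep ι_K χ k` ON ALL OF `𝓢(ℝ^σ)` (the datum's
`exists_vacChar` + `toL2_compactWeilRep` + `toL2`-injectivity); in particular its torus weights and its action on the
Gaussian are the closed formulas of `SchwartzCompactWeilRep`.  (Deliberate dot-notation extension of the structure
`Literature.NumberTheory.Weil1964.IsArchWeilDatum` from this directory.) [cite: Folland1989, Prop (4.39)] -/
theorem _root_.Literature.NumberTheory.Weil1964.IsArchWeilDatum.exists_eq_compactWeilRep {Ginf : Type*} [Group Ginf]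
    [TopologicalSpace Ginf] {ι𝕎 : Ginf →* symplecticGroup (polar (dotPairing σ))}
    {ω : Representation ℂ Ginf (SchwartzMap (σ → ℝ) ℂ)} (hW : IsArchWeilDatum ι𝕎 ω) (κ : H →* Ginf)
    (hκ : Continuous κ) (ιK : H →* Matrix.unitaryGroup σ ℂ) (hcomp : ∀ k, ι𝕎 (κ k) = realifySp σ (ιK k)) :
    ∃ χ : H →* Circle, Continuous χ ∧ ∀ (k : H) (f : SchwartzMap (σ → ℝ) ℂ), ω (κ k) f = compactWeilRep ιK χ k f := by
  obtain ⟨χ, hχ, h⟩ := hW.exists_vacChar κ hκ ιK hcomp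
  refine ⟨χ, hχ, fun k f => toL2_injective ?_⟩
  rw [h, toL2_compactWeilRep]

/-- … hence on the torus of `K`: `ω (κ k) h_α = (χ k · torusChar α t) • h_α` whenever `ι_K k = diag t`, and on the
Gaussian `ω (κ k) h_0 = χ k • h_0`, for ONE continuous character `χ` of `K` (dot-notation extension of
`IsArchWeilDatum`, as above). [cite: Folland1989, §1.7] -/
theorem _root_.Literature.NumberTheory.Weil1964.IsArchWeilDatum.exists_torus_weights {Ginf : Type*} [Group Ginf]
    [TopologicalSpace Ginf] {ι𝕎 : Ginf →* symplecticGroup (polar (dotPairing σ))}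
    {ω : Representation ℂ Ginf (SchwartzMap (σ → ℝ) ℂ)} (hW : IsArchWeilDatum ι𝕎 ω) (κ : H →* Ginf)
    (hκ : Continuous κ) (ιK : H →* Matrix.unitaryGroup σ ℂ) (hcomp : ∀ k, ι𝕎 (κ k) = realifySp σ (ιK k)) :
    ∃ χ : H →* Circle, Continuous χ ∧
      (∀ (k : H) (t : σ → Circle), ιK k = diagHom t →
        ∀ α : σ →₀ ℕ, ω (κ k) (hermitePi α) = ((((χ k : Circle) : ℂ)) * torusChar α t) • hermitePi α) ∧
      ∀ k : H, ω (κ k) (hermitePi 0) = ((χ k : Circle) : ℂ) • hermitePi 0 := by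
  obtain ⟨χ, hχ, h⟩ := hW.exists_eq_compactWeilRep κ hκ ιK hcomp
  exact ⟨χ, hχ, fun k t ht α => by rw [h, compactWeilRep_hermitePi_of_diag ιK χ ht],
    fun k => by rw [h, compactWeilRep_hermitePi_zero]⟩

section DualPair

variable {P Q R S : Type*} [Fintype P] [DecidableEq P] [Fintype Q] [DecidableEq Q] [Fintype R] [DecidableEq R]
  [Fintype S] [DecidableEq S]

/-- **The compact dual pair is an archimedean Weil datum** through its block datum `dualPairι`, for every continuous
unitary character `χ` of `(U(P)×U(Q))×(U(R)×U(S))`. [cite: Folland1989, Prop (4.39)] -/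
theorem isArchWeilDatum_dualPairWeilRep (χ : DPK P Q R S →* Circle) (hχ : Continuous χ) :
    IsArchWeilDatum ((realifySp (DPIdx P Q R S)).comp dualPairι) (dualPairWeilRep χ) :=
  isArchWeilDatum_compactWeilRep dualPairι χ continuous_dualPairι hχ

/-- Hence the existential form consumed by the theta lane: `∃ ω, IsArchWeilDatum (realifySp ∘ dualPairι) ω`, with the
torus weights of the witness explicit (`dualPairWeilRep_hermitePi_torus`). [cite: Folland1989, Prop (4.39)] -/
theorem exists_isArchWeilDatum_dualPair (χ : DPK P Q R S →* Circle) (hχ : Continuous χ) :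
    ∃ ω : Representation ℂ (DPK P Q R S) (SchwartzMap (DPIdx P Q R S → ℝ) ℂ),
      IsArchWeilDatum ((realifySp (DPIdx P Q R S)).comp dualPairι) ω ∧
        ∀ (k : DPK P Q R S) (f : SchwartzMap (DPIdx P Q R S → ℝ) ℂ),
          toL2 (ω k f) = ((χ k : Circle) : ℂ) • schrodingerU (dualPairι k) (toL2 f) :=
  ⟨dualPairWeilRep χ, isArchWeilDatum_dualPairWeilRep χ hχ, fun k f => toL2_compactWeilRep dualPairι χ k f⟩

end DualPair

end Literature.Analysis.SegalBargmann
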